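import Summits.MatrixMultiplication.MatrixMultiplication.Theorems.SoloInformedCommonEigenbasis
import Literature.Computability.AlgebraicComplexity.TensorRestrictionRank
import HarnessLib

/-!
# Theorem U: a 111-abundant tensor with maximal asymptotic subrank is a unit tensor

Solo programme `solo-MatrixMultiplication-informed` (gen 20), claim c208.

**Theorem U** (`AbundantUnit.unit_of_asymptoticSubrank_eq_card`).  Let `s ∈ ℂ^{ι×κ×μ}` be
concise with `|ι| = |κ| = |μ| = d`, suppose `dim 𝔞(s) ≥ d` where `𝔞(s) = ker (lin111 s)` is the
111-algebra (this holds for every 111-abundant tensor in the sense of Jelisiejew–Landsberg–Pal,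
in particular for every concise tensor of minimal border rank `d`), and suppose `Q̃(s) = d`.
Then `s ≅ ⟨d⟩`: `⟨d⟩ ≥ s` and `s ≥ ⟨d⟩` under restriction.  Equivalently
(`AbundantUnit.dichotomy`): a concise tensor of cubic format `d` with `dim 𝔞(s) ≥ d` has
`Q̃(s) < d` unless it is isomorphic to the unit tensor `⟨d⟩`.  This extends
[BlaserLysikov2020, Thm. 17] (tensors of minimal border rank) to the strictly larger
111-abundant class, by an argument that never leaves linear algebra:

1. Theorem S on all three legs (`CommonEigenbasis.isSemisimple₁₂₃_of_asymptoticSubrank_eq_card`):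
   `Q̃(s) = d` forces every `(P,Q,R) ∈ 𝔞(s)` to have three semisimple components; `𝔞(s)` is
   commutative on each leg (`IsTriple.comm₁/₂/₃`); so each leg carries a common eigenbasis
   (E4, `exists_basis_conj_diagonal`) and we pass to the coordinate tensor
   `t = (D_A ⊗ D_B ⊗ D_C)·s ∈ ℂ^{d×d×d}`, in which `𝔞` acts by triples of diagonal matrices.
2. The first projection `𝔞(s) → {diagonal matrices}` is injective (conciseness) from a space of
   dimension `≥ d` to one of dimension `d`, hence onto: for every `a` there is a triple
   `(E_aa, diag φ_a, diag ψ_a) ∈ 𝔞(t)`.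
3. Reading `E_aa ·₁ t = diag φ_a ·₂ t = diag ψ_a ·₃ t` entrywise: every `B`-index and every
   `C`-index met by the slice `t_a` is met by no other slice, and every slice is non-zero
   (conciseness); hence the support of `t` is the graph `{(z, σ z, τ z)}` of two permutations
   and `t = Σ_z λ_z e_z ⊗ e_{σ z} ⊗ e_{τ z}`, `λ_z ≠ 0`, i.e. `t ≅ ⟨d⟩`.

References: [cite: BlaserLysikov2020, Thm. 16, Thm. 17, §2.3];
[cite: JelisiejewLandsbergPal2023, Def. 1.9, Thm. 1.10, §1.4].
-/

open scoped BigOperators Matrix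
open Matrix

namespace Summit.MatrixMultiplication.MatrixMultiplication.Theorems

open Literature.Computability.AlgebraicComplexity

namespace AbundantUnit

open OneOneOneAlgebra NilpotentUnstable Semisimple111 SquareZeroNormalForm CommonEigenbasis

/-! ## Preliminaries: diagonal contractions, selector sums, coordinate round trips -/

section Prelim

variable {K : Type*} [Field K] {ι κ μ : Type*} [Fintype ι] [Fintype κ] [Fintype μ]
  [DecidableEq ι] [DecidableEq κ] [DecidableEq μ]

omit [Fintype κ] [Fintype μ] [DecidableEq κ] [DecidableEq μ] in
/-- `(diag v) ·₁ t` rescales the `A`-slices: `((diag v) ·₁ t)_{zxy} = v_z t_{zxy}`. [folklore] -/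
theorem contract₁_diagonal (v : ι → K) (t : ι → κ → μ → K) (z : ι) (x : κ) (y : μ) :
    contract₁ (Matrix.diagonal v) t z x y = v z * t z x y := by
  rw [contract₁_apply, Finset.sum_eq_single z]
  · rw [Matrix.diagonal_apply_eq]
  · intro z' _ hz'
    rw [Matrix.diagonal_apply_ne _ (Ne.symm hz'), zero_mul]
  · intro h
    exact absurd (Finset.mem_univ z) h

omit [Fintype ι] [Fintype μ] [DecidableEq ι] [DecidableEq μ] in
/-- `(diag w) ·₂ t` rescales the `B`-slices. [folklore] -/
theorem contract₂_diagonal (w : κ → K) (t : ι → κ → μ → K) (z : ι) (x : κ) (y : μ) :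
    contract₂ (Matrix.diagonal w) t z x y = w x * t z x y := by
  rw [contract₂_apply, Finset.sum_eq_single x]
  · rw [Matrix.diagonal_apply_eq]
  · intro x' _ hx'
    rw [Matrix.diagonal_apply_ne _ (Ne.symm hx'), zero_mul]
  · intro h
    exact absurd (Finset.mem_univ x) h

omit [Fintype ι] [Fintype κ] [DecidableEq ι] [DecidableEq κ] in
/-- `(diag u) ·₃ t` rescales the `C`-slices. [folklore] -/
theorem contract₃_diagonal (u : μ → K) (t : ι → κ → μ → K) (z : ι) (x : κ) (y : μ) :
    contract₃ (Matrix.diagonal u) t z x y = u y * t z x y := by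
  rw [contract₃_apply, Finset.sum_eq_single y]
  · rw [Matrix.diagonal_apply_eq]
  · intro y' _ hy'
    rw [Matrix.diagonal_apply_ne _ (Ne.symm hy'), zero_mul]
  · intro h
    exact absurd (Finset.mem_univ y) h

/-- A triple sum against three selector vectors picks out one (rescaled) entry. [folklore] -/
theorem sum_selector (u : ι → κ → μ → K) (r : K) (z₀ : ι) (x₀ : κ) (y₀ : μ) :
    (∑ z, ∑ x, ∑ y, (if z₀ = z then r else 0) * (if x = x₀ then (1 : K) else 0) *
      (if y = y₀ then (1 : K) else 0) * u z x y) = r * u z₀ x₀ y₀ := by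
  rw [Finset.sum_eq_single z₀]
  · rw [Finset.sum_eq_single x₀]
    · rw [Finset.sum_eq_single y₀]
      · simp
      · intro y _ hy
        simp [hy]
      · intro h
        exact absurd (Finset.mem_univ _) h
    · intro x _ hx
      exact Finset.sum_eq_zero fun y _ => by simp [hx]
    · intro h
      exact absurd (Finset.mem_univ _) h
  · intro z _ hz
    exact Finset.sum_eq_zero fun x _ => Finset.sum_eq_zero fun y _ => by simp [Ne.symm hz]
  · intro h
    exact absurd (Finset.mem_univ _) h

omit [Fintype ι] [Fintype κ] [Fintype μ] [DecidableEq ι] [DecidableEq κ] [DecidableEq μ] in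
/-- Entries of `(A ⊗ B ⊗ C)·⟨d⟩`: `Σ_i A_{ai} B_{bi} C_{ci}`. [folklore] -/
theorem sum_unitTensor {d : ℕ} (A : Matrix ι (Fin d) K) (B : Matrix κ (Fin d) K)
    (C : Matrix μ (Fin d) K) (a : ι) (b : κ) (c : μ) :
    (∑ i, ∑ j, ∑ k, A a i * B b j * C c k * unitTensor K d i j k) =
      ∑ i, A a i * B b i * C c i := by
  refine Finset.sum_congr rfl fun i _ => ?_
  rw [Finset.sum_eq_single i]
  · rw [Finset.sum_eq_single i]
    · simp
    · intro k _ hk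
      simp [Ne.symm hk]
    · intro h
      exact absurd (Finset.mem_univ _) h
  · intro j _ hj
    exact Finset.sum_eq_zero fun k _ => by simp [Ne.symm hj]
  · intro h
    exact absurd (Finset.mem_univ _) h

variable {α β γ : Type*} [Fintype α] [Fintype β] [Fintype γ]

/-- Round trip of coordinates: `(E_A ⊗ E_B ⊗ E_C)·((D_A ⊗ D_B ⊗ D_C)·u) = u`. [folklore] -/
theorem actTensor_vecMat_dualMat (bA : Module.Basis α K (ι → K)) (bB : Module.Basis β K (κ → K))
    (bC : Module.Basis γ K (μ → K)) (u : ι → κ → μ → K) :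
    actTensor (vecMat bA) (vecMat bB) (vecMat bC)
      (actTensor (dualMat bA) (dualMat bB) (dualMat bC) u) = u := by
  rw [actTensor_actTensor, vecMat_mul_dualMat, vecMat_mul_dualMat, vecMat_mul_dualMat,
    actTensor_one]

omit [Fintype κ] [Fintype μ] [DecidableEq κ] [DecidableEq μ] in
/-- Round trip of conjugation: `E (D M E) D = M`. [folklore] -/
theorem vecMat_mul_conj_mul_dualMat (b : Module.Basis α K (ι → K)) (M : Matrix ι ι K) :
    vecMat b * (dualMat b * M * vecMat b) * dualMat b = M := by
  rw [← Matrix.mul_assoc, ← Matrix.mul_assoc, vecMat_mul_dualMat, Matrix.one_mul,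
    Matrix.mul_assoc, vecMat_mul_dualMat, Matrix.mul_one]

end Prelim

/-! ## Theorem U -/

section TheoremU

variable {ι κ μ : Type} [Fintype ι] [Fintype κ] [Fintype μ] [DecidableEq ι] [DecidableEq κ]
  [DecidableEq μ]

omit [DecidableEq ι] [DecidableEq κ] [DecidableEq μ] in
/-- 111-abundance in the linear-independence form of [JLP23] gives `d ≤ dim 𝔞(s)`.
[cite: JelisiejewLandsbergPal2023, Def. 1.9] -/
theorem le_finrank_ker_of_is111Abundant {s : ι → κ → μ → ℂ} {d : ℕ} (h : Is111Abundant d s) :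
    d ≤ Module.finrank ℂ (LinearMap.ker (lin111 s)) := by
  obtain ⟨g, hg, hker⟩ := h
  let g' : Fin d → LinearMap.ker (lin111 s) := fun i => ⟨g i, LinearMap.mem_ker.2 (hker i)⟩
  have hg' : LinearIndependent ℂ g' :=
    LinearIndependent.of_comp (LinearMap.ker (lin111 s)).subtype (by exact hg)
  simpa using hg'.fintype_card_le_finrank

/-- **Theorem U** (solo programme, claim c208).  A concise tensor `s ∈ ℂ^{ι×κ×μ}` of cubic format
`d` with `dim 𝔞(s) ≥ d` and maximal asymptotic subrank `Q̃(s) = d` is isomorphic to the unit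
tensor: `⟨d⟩ ≥ s` and `s ≥ ⟨d⟩`.  Extends [cite: BlaserLysikov2020, Thm. 17] from minimal border
rank to 111-abundance; uses [cite: JelisiejewLandsbergPal2023, Thm. 1.10]. -/
theorem unit_of_asymptoticSubrank_eq_card (s : ι → κ → μ → ℂ) (hs : IsConcise3 s) {d : ℕ}
    (hι : Fintype.card ι = d) (hκ : Fintype.card κ = d) (hμ : Fintype.card μ = d)
    (hab : d ≤ Module.finrank ℂ (LinearMap.ker (lin111 s))) (hQ : asymptoticSubrank ℂ s = d) :
    TensorRestrictsTo (unitTensor ℂ d) s ∧ TensorRestrictsTo s (unitTensor ℂ d) := by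
  -- Step 0: the 111-algebra `W = 𝔞(s)`, its triples, semisimplicity and commutativity.
  set W : Submodule ℂ (TripleIndex ι κ μ → ℂ) := LinearMap.ker (lin111 s) with hWdef
  have htr : ∀ c : W, IsTriple s (projA c.1) (projB c.1) (projC c.1) := fun c =>
    isTriple_of_lin111_eq_zero (LinearMap.mem_ker.1 c.2)
  have hss := fun c : W => isSemisimple₁₂₃_of_asymptoticSubrank_eq_card s hs hι hκ hμ hQ (htr c)
  -- Step 1: common eigenbases on the three legs (E4).
  obtain ⟨bA, hbA⟩ := exists_basis_conj_diagonal (fun c : W => projA c.1)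
    (fun c c' => IsTriple.comm₁ hs.1 (htr c) (htr c')) (fun c => (hss c).1) hι
  obtain ⟨bB, hbB⟩ := exists_basis_conj_diagonal (fun c : W => projB c.1)
    (fun c c' => IsTriple.comm₂ hs.1 hs.2.1 (htr c) (htr c')) (fun c => (hss c).2.1) hκ
  obtain ⟨bC, hbC⟩ := exists_basis_conj_diagonal (fun c : W => projC c.1)
    (fun c c' => IsTriple.comm₃ hs.1 hs.2.2 (htr c) (htr c')) (fun c => (hss c).2.2) hμ
  have hbA' : ∀ c : W, ∃ v : Fin d → ℂ,
      dualMat bA * projA c.1 * vecMat bA = Matrix.diagonal v := hbA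
  have hbB' : ∀ c : W, ∃ v : Fin d → ℂ,
      dualMat bB * projB c.1 * vecMat bB = Matrix.diagonal v := hbB
  have hbC' : ∀ c : W, ∃ v : Fin d → ℂ,
      dualMat bC * projC c.1 * vecMat bC = Matrix.diagonal v := hbC
  -- Step 2: the conjugated first projection maps `W` ONTO the diagonal matrices
  -- (injective by conciseness, `dim W ≥ d = dim {diagonal matrices}`).
  have hfull : ∀ a : Fin d, ∃ c : W,
      dualMat bA * projA c.1 * vecMat bA = Matrix.diagonal (Pi.single a 1) := by
    let f : W →ₗ[ℂ] Matrix (Fin d) (Fin d) ℂ :=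
      { toFun := fun c => dualMat bA * projA c.1 * vecMat bA
        map_add' := fun c c' => by
          simp only [Submodule.coe_add, map_add, Matrix.mul_add, Matrix.add_mul]
        map_smul' := fun r c => by
          simp only [Submodule.coe_smul, map_smul, Matrix.mul_smul, Matrix.smul_mul,
            RingHom.id_apply] }
    have hf_inj : Function.Injective f := by
      intro c c' h
      have h' : dualMat bA * projA c.1 * vecMat bA = dualMat bA * projA c'.1 * vecMat bA := h
      have h'' : projA c.1 = projA c'.1 := by
        rw [← vecMat_mul_conj_mul_dualMat bA (projA c.1), h', vecMat_mul_conj_mul_dualMat]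
      exact Subtype.ext (projA_injOn_ker hs c.2 c'.2 h'')
    let D : (Fin d → ℂ) →ₗ[ℂ] Matrix (Fin d) (Fin d) ℂ := Matrix.diagonalLinearMap (Fin d) ℂ ℂ
    have hD_inj : Function.Injective D := fun v w h => Matrix.diagonal_injective h
    have hle : LinearMap.range f ≤ LinearMap.range D := by
      rintro _ ⟨c, rfl⟩
      obtain ⟨v, hv⟩ := hbA' c
      exact ⟨v, hv.symm⟩
    have hfin : Module.finrank ℂ (LinearMap.range D) ≤ Module.finrank ℂ (LinearMap.range f) := by
      rw [LinearMap.finrank_range_of_inj hD_inj, LinearMap.finrank_range_of_inj hf_inj,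
        Module.finrank_fintype_fun_eq_card, Fintype.card_fin]
      exact hab
    have heq : LinearMap.range f = LinearMap.range D := Submodule.eq_of_le_of_finrank_le hle hfin
    intro a
    have hmem : D (Pi.single a 1) ∈ LinearMap.range f := by
      rw [heq]
      exact LinearMap.mem_range_self D _
    obtain ⟨c, hc⟩ := hmem
    exact ⟨c, hc⟩
  -- Step 3: for each `a`, a triple `(E_aa, diag φ_a, diag ψ_a) ∈ 𝔞(t)` of the coordinate tensor.
  choose cA hcA using hfull
  choose φ hφ using fun a => hbB' (cA a)
  choose ψ hψ using fun a => hbC' (cA a)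
  set t : Fin d → Fin d → Fin d → ℂ := actTensor (dualMat bA) (dualMat bB) (dualMat bC) s
    with htdef
  have key₁ : ∀ a, contract₁ (Matrix.diagonal (Pi.single a (1 : ℂ))) t =
      contract₂ (Matrix.diagonal (φ a)) t := fun a => by
    rw [← hcA a, ← hφ a, htdef, contract₁_coords, contract₂_coords, (htr (cA a)).1]
  have key₂ : ∀ a, contract₂ (Matrix.diagonal (φ a)) t =
      contract₃ (Matrix.diagonal (ψ a)) t := fun a => by
    rw [← hφ a, ← hψ a, htdef, contract₂_coords, contract₃_coords, (htr (cA a)).2]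
  have keyB : ∀ a z x y, (Pi.single a (1 : ℂ) : Fin d → ℂ) z * t z x y = φ a x * t z x y :=
    fun a z x y => by
    have h := congr_fun (congr_fun (congr_fun (key₁ a) z) x) y
    rwa [contract₁_diagonal, contract₂_diagonal] at h
  have keyC : ∀ a z x y, φ a x * t z x y = ψ a y * t z x y := fun a z x y => by
    have h := congr_fun (congr_fun (congr_fun (key₂ a) z) x) y
    rwa [contract₂_diagonal, contract₃_diagonal] at h
  -- Step 4: every `A`-slice of `t` is non-zero (conciseness of `s`).
  have hslice : ∀ a : Fin d, ∃ x y, t a x y ≠ 0 := by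
    intro a
    by_contra hall
    have hall' : ∀ x y, t a x y = 0 := fun x y => by
      by_contra h
      exact hall ⟨x, y, h⟩
    have h0 : contract₁ (Matrix.diagonal (Pi.single a (1 : ℂ))) t = 0 := by
      funext z x y
      rw [contract₁_diagonal]
      change _ = (0 : ℂ)
      by_cases hz : z = a
      · rw [hz, hall' x y, mul_zero]
      · rw [Pi.single_eq_of_ne hz, zero_mul]
    have h1 : actTensor (dualMat bA) (dualMat bB) (dualMat bC) (contract₁ (projA (cA a).1) s) =
        0 := by
      rw [← contract₁_coords, hcA a, ← htdef, h0]
    have h2 : contract₁ (projA (cA a).1) s = 0 := by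
      have h3 := congr_arg (actTensor (vecMat bA) (vecMat bB) (vecMat bC)) h1
      rwa [actTensor_vecMat_dualMat, actTensor_zero] at h3
    have h4 : projA (cA a).1 = 0 := eq_zero_of_contract₁_eq_zero hs.1 h2
    have h5 := congr_fun (congr_fun (hcA a) a) a
    rw [h4, Matrix.mul_zero, Matrix.zero_mul, Matrix.zero_apply, Matrix.diagonal_apply_eq,
      Pi.single_eq_same] at h5
    exact zero_ne_one h5
  -- Step 5: the eigenvalue bookkeeping — each `B`-index / `C`-index is owned by one slice.
  have hφ_one : ∀ a x y, t a x y ≠ 0 → φ a x = 1 := fun a x y h => by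
    have k := keyB a a x y
    rw [Pi.single_eq_same, one_mul] at k
    exact (mul_eq_right₀ h).1 k.symm
  have hψ_one : ∀ a x y, t a x y ≠ 0 → ψ a y = 1 := fun a x y h => by
    have k := keyC a a x y
    rw [hφ_one a x y h, one_mul] at k
    exact (mul_eq_right₀ h).1 k.symm
  have ownB : ∀ a z x y y', t a x y ≠ 0 → t z x y' ≠ 0 → z = a := fun a z x y y' h h' => by
    by_contra hz
    have k := keyB a z x y'
    rw [Pi.single_eq_of_ne hz, zero_mul, hφ_one a x y h, one_mul] at k
    exact h' k.symm
  have ownC : ∀ a z x x' y, t a x y ≠ 0 → t z x' y ≠ 0 → z = a := fun a z x x' y h h' => by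
    by_contra hz
    have k := keyB a z x' y
    have k' := keyC a z x' y
    rw [Pi.single_eq_of_ne hz, zero_mul] at k
    rw [← k, hψ_one a x y h, one_mul] at k'
    exact h' k'.symm
  -- Step 6: the support of `t` is the graph of two permutations `σ`, `τ`.
  choose σ τ hστ using hslice
  have hσ : Function.Injective σ := fun a a' h => by
    have h2 : t a' (σ a) (τ a') ≠ 0 := by rw [h]; exact hστ a'
    exact (ownB a a' (σ a) (τ a) (τ a') (hστ a) h2).symm
  have hτ : Function.Injective τ := fun a a' h => by
    have h2 : t a' (σ a') (τ a) ≠ 0 := by rw [h]; exact hστ a'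
    exact (ownC a a' (σ a) (σ a') (τ a) (hστ a) h2).symm
  have hsupp : ∀ z x y, t z x y ≠ 0 → x = σ z ∧ y = τ z := fun z x y h => by
    obtain ⟨a, rfl⟩ := Finite.surjective_of_injective hσ x
    obtain ⟨a', rfl⟩ := Finite.surjective_of_injective hτ y
    have ha : z = a := ownB a z (σ a) (τ a) (τ a') (hστ a) h
    have ha' : z = a' := ownC a' z (σ a') (σ a) (τ a') (hστ a') h
    refine ⟨?_, ?_⟩
    · rw [ha]
    · rw [ha']
  have htval : ∀ z x y, t z x y = if x = σ z ∧ y = τ z then t z (σ z) (τ z) else 0 :=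
    fun z x y => by
    split_ifs with h
    · rw [h.1, h.2]
    · by_contra hne
      exact h (hsupp z x y hne)
  -- Step 7: `⟨d⟩ ≥ t` and `t ≥ ⟨d⟩` by explicit (monomial) matrices.
  have hUt : TensorRestrictsTo (unitTensor ℂ d) t := by
    refine (tensorRestrictsTo_iff_exists_actTensor _ _).2
      ⟨Matrix.of fun z i => if z = i then t z (σ z) (τ z) else 0,
        Matrix.of fun x j => if x = σ j then (1 : ℂ) else 0,
        Matrix.of fun y k => if y = τ k then (1 : ℂ) else 0, ?_⟩
    funext z x y
    rw [actTensor_apply, sum_unitTensor, Finset.sum_eq_single z]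
    · rw [htval z x y]
      by_cases hx : x = σ z <;> by_cases hy : y = τ z <;> simp [Matrix.of_apply, hx, hy]
    · intro i _ hi
      simp [Matrix.of_apply, Ne.symm hi]
    · intro h
      exact absurd (Finset.mem_univ _) h
  have htU : TensorRestrictsTo t (unitTensor ℂ d) := by
    refine (tensorRestrictsTo_iff_exists_actTensor _ _).2
      ⟨Matrix.of fun i z => if i = z then (t i (σ i) (τ i))⁻¹ else 0,
        Matrix.of fun j x => if x = σ j then (1 : ℂ) else 0,
        Matrix.of fun k y => if y = τ k then (1 : ℂ) else 0, ?_⟩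
    funext i j k
    rw [actTensor_apply]
    simp only [Matrix.of_apply]
    rw [sum_selector, htval i (σ j) (τ k), unitTensor_apply]
    by_cases hj : j = i
    · by_cases hk : k = i
      · subst hj; subst hk; simp [hστ]
      · simp [hj, hk, Ne.symm hk, hτ.eq_iff]
    · simp [hj, Ne.symm hj, hσ.eq_iff]
  -- Conclusion: transport back along the change of coordinates.
  exact ⟨hUt.trans (restrictsTo_of_coords bA bB bC s),
    (tensorRestrictsTo_actTensor (dualMat bA) (dualMat bB) (dualMat bC) s).trans htU⟩

/-- **Theorem U** for 111-abundant tensors in the sense of [JLP23] (`Is111Abundant d s`: `d`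
linearly independent triples in `𝔞(s)`); in particular for concise tensors of minimal border rank
`d` [cite: JelisiejewLandsbergPal2023, §1.4], recovering [cite: BlaserLysikov2020, Thm. 17]. -/
theorem unit_of_is111Abundant (s : ι → κ → μ → ℂ) (hs : IsConcise3 s) {d : ℕ}
    (hι : Fintype.card ι = d) (hκ : Fintype.card κ = d) (hμ : Fintype.card μ = d)
    (hab : Is111Abundant d s) (hQ : asymptoticSubrank ℂ s = d) :
    TensorRestrictsTo (unitTensor ℂ d) s ∧ TensorRestrictsTo s (unitTensor ℂ d) :=
  unit_of_asymptoticSubrank_eq_card s hs hι hκ hμ (le_finrank_ker_of_is111Abundant hab) hQ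

/-- **Dichotomy form of Theorem U.**  A concise tensor of cubic format `d` with `dim 𝔞(s) ≥ d`
has `Q̃(s) < d`, unless it is isomorphic to `⟨d⟩` (and then `Q̃(s) = d`).
[cite: BlaserLysikov2020, Thm. 16, Thm. 17] -/
theorem dichotomy (s : ι → κ → μ → ℂ) (hs : IsConcise3 s) {d : ℕ}
    (hι : Fintype.card ι = d) (hκ : Fintype.card κ = d) (hμ : Fintype.card μ = d)
    (hab : d ≤ Module.finrank ℂ (LinearMap.ker (lin111 s))) :
    asymptoticSubrank ℂ s < d ∨
      (TensorRestrictsTo (unitTensor ℂ d) s ∧ TensorRestrictsTo s (unitTensor ℂ d)) := by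
  have hle : asymptoticSubrank ℂ s ≤ d := by
    have h := (Literature.Barriers.MatrixMultiplication.asymptoticSubrank_le_card₁₂₃ s).1
    rwa [hι] at h
  rcases hle.lt_or_eq with h | h
  · exact Or.inl h
  · exact Or.inr (unit_of_asymptoticSubrank_eq_card s hs hι hκ hμ hab h)

end TheoremU

end AbundantUnit

end Summit.MatrixMultiplication.MatrixMultiplication.Theorems
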